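import Summits.Ventures.HSemireg.WedgeHankelSubstitutionNodes
import Summits.Ventures.HSemireg.WedgeHankelSubstitutionCatalecticant
import Summits.Ventures.HSemireg.WedgeHankelSubstitutionSiegel
import Summits.Ventures.HSemireg.WedgeHankelBoxDivisors
import Summits.Ventures.HSemireg.WedgeHankelNodeTorelli

/-!
# Venture HSemireg — THE GENERAL LINEAR SUBSTITUTION (4): THE MOMENTS IN CLOSED FORM `(sbSeq α β γ δ m q)_j = Σ_{s,t} C(m−j,s) C(j,t) α^{m−j−s} γ^s β^{j−t} δ^t q_{s+t}`,
# SINGULAR SUBSTITUTIONS EVALUATE THE CLASS AND PROJECT ONTO THE PURE CLASS OF THE IMAGE LINE, and A SUBSTITUTION FIXES A NODE KERNEL IFF IT FIXES THE NODE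

HONEST FRAMING. Part of the Lean index of the computation cell `pub-hsemireg` (seat p10 gen 18, Sunday typer «UNIFORM-IN-n»).
Finite-dimensional EXTERIOR ALGEBRA over a field ONLY: no variety, no cohomology theory, no sheaf, no Ext group, no semiregularity map;
nothing here says that HC / HC_CM / HC_AV holds; no Literature fact is declared or used.  Custodian versions as in `WedgeHankelSiegelIdeal` (1/3) and `WedgeHankelFrameChange`;
the dictionary (the moments `q_j = L(u^{m−j}v^j)` of a functional `L` on binary forms of degree `m`; under the substitution they become `L((αu+γv)^{m−j}(βu+δv)^j)`; a rank-one
substitution = a degenerate frame) is QUOTED, never asserted.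

WHAT IS IN THE TREE.  H1 `sbSeq` (double recursion), `Sb_w`, `expMul_eq_sum`, E12 `scaleSeq` / `shift_scaleSeq`; H1b `rank_hankel1_sbSeq`; H6 `Kr_w_expMul_sum_eq_iInf_of_le`; H2 `Sb_w_eq_w_expMul` (`α ≠ 0`), `Sb_zero_eq_Ψs_Sb_lower`, `Kr_Sb_w_expMul_of_order`
(the Möbius theorem); E5 `expMul_spike_zero`, `Kr_w_exp_eq` (pure class: kernel = frame ideal); G7 `eq_of_Kr_w_expMul_eq` (node Torelli).  THIS FILE (namespace
`Summit.Ventures.HSemireg.Wedge.HankelFrameChange` continued):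
* §137 THE MOMENTS IN CLOSED FORM (H7 `shift_iterate_apply`): **`sbSeq_apply_zero`: `sbSeq α β γ δ m q 0 = expMul α (scaleSeq γ q) m = Σ_{s ≤ m} C(m,s) α^{m−s} γ^s q_s`** (the `x`-recursion IS
  E5's Pascal recursion on the `γ`-scaled sequence), and for every `j ≤ m` **`sbSeq_eq_expMul_expMul`: `sbSeq α β γ δ m q j = expMul β (scaleSeq δ (t ↦ expMul α (scaleSeq γ (σ^t q)) (m−j))) j`**
  (the `y`-recursion is E5's recursion in `β, δ` over the first moments of the shifted sequences) — whence the dictionary's double binomial sum **`sbSeq_eq_sum`**.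
* §138 SINGULAR SUBSTITUTIONS (`αδ = βγ`): `sbSeq_lower_zero_succ` (`δ = 0 = β`: only the `0`-th moment survives); **`Sb_w_of_det_eq_zero`** (`α ≠ 0`): `Sb α β γ δ (w_n q) = w_n(c·(β/α)^•)` with
  `c = expMul α (scaleSeq γ q) n` — the class is EVALUATED (`c` = the binary form at the kernel direction) and projected onto the PURE class of the image frame letter `x + (β/α)y`
  (kernel `Φs (β/α) xRich(k,0)` = the frame ideal, `Kr_Sb_w_of_det_eq_zero`, or everything if `c = 0`); `Sb_w_of_alpha_gamma_zero` (`x ↦ βy`, `y ↦ δy`: onto the point class `c·δ_n`);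
  `Sb_w_of_alpha_beta_zero` (`x ↦ 0`: `q_n ·` the volume of the frame `(γ, δ)`).  With H1's `Sb_w_rank_one` every non-invertible substitution is covered.
* §139 STABILIZERS: **`Kr_Sb_w_expMul_eq_iff`**: for a node-`λ` class of exact order `P < k` (`k + P ≤ n`), `αδ − βγ ≠ 0`, `α + λγ ≠ 0`:
  `Kr(univ, Sb α β γ δ (w_n(expMul λ q)), k) = Kr(univ, w_n(expMul λ q), k)` IFF `β + λδ = λ(α + λγ)` — a substitution fixes the kernel of a node class iff the node is a FIXED POINT of
  its Möbius map (H2 + G7); `Kr_Sb_w_expMul_eq_Kr_iff` (two substitutions give the same kernel iff they move the node to the same place).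
* §139′ DIVISOR CLASSES UNDER INVERTIBLE SUBSTITUTIONS: `rank_hankel1_sbSeq_expMul_of_order` (a moved node class keeps its confluent rank `min(P,k)+1`, H1b + E6), and
  **`Kr_Sb_w_expMul_sum_of_le`**: for distinct nodes all kept finite (`α + λ_iγ ≠ 0`), exact orders, `k + P_i ≤ n`, `D ≤ n + 1 − k`:
  `Kr(univ, Sb α β γ δ (w_n(Σ_i expMul λ_i q_i)), k) = ⋂_i (SI_k ⊔ Φs ((β+λ_iδ)/(α+λ_iγ)) xRich(k, P_i))` — the kernel of a moved divisor class is the intersection of the MOVED node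
  kernels (H2 `Sb_w_expMul_sum` + `mobius_comp_injective` + H6's uniform divisor kernel law).
NOT typed here: the symmetric-power matrices `S^k(g)` with `H_k(sbSeq g q) = S^k(g)ᵀ H_k(q) S^{n−k}(g)` (the matrix form of the rank invariance H1b proves class-side); anything Ext-side.
Class side only; new names only.
-/

open Module

namespace Summit.Ventures.HSemireg.Wedge.HankelFrameChange

open Summit.Ventures.HSemireg.Wedge Summit.Ventures.HSemireg.Wedge.Kunneth Summit.Ventures.HSemireg.Wedge.Hankel
  Summit.Ventures.HSemireg.Wedge.BasisFree Summit.Ventures.HSemireg.Wedge.HankelSiegel Summit.Ventures.HSemireg.Wedge.HankelSiegelIdeal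
  Summit.Ventures.HSemireg.Wedge.KunnethKernel Summit.Ventures.HSemireg.Wedge.HankelRankOne

variable (K : Type*) [Field K] {n : ℕ}

/-! ## §137. The moments in closed form -/

/-- **THE `0`-TH MOMENT: `sbSeq α β γ δ m q 0 = expMul α (scaleSeq γ q) m`** — the `x`-recursion `(m+1, 0) ↦ α·(m, q, 0) + γ·(m, σq, 0)` is E5's Pascal recursion for the node `α` on the
`γ`-scaled sequence. -/
theorem sbSeq_apply_zero (α β γ δ : K) : ∀ (m : ℕ) (q : ℕ → K), sbSeq K α β γ δ m q 0 = expMul K α (scaleSeq K γ q) m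
  | 0, q => by simp only [sbSeq_zero_zero, expMul_zero, scaleSeq, pow_zero, one_mul]
  | m + 1, q => by
    have e : expMul K α (shift K (scaleSeq K γ q)) m = γ * expMul K α (scaleSeq K γ (shift K q)) m := by
      rw [shift_scaleSeq, expMul_smul]
    rw [sbSeq_succ_zero, sbSeq_apply_zero α β γ δ m q, sbSeq_apply_zero α β γ δ m (shift K q), expMul_succ, e]

/-- … in closed form: **`sbSeq α β γ δ m q 0 = Σ_{s ≤ m} C(m,s) α^{m−s} γ^s q_s`**. -/
theorem sbSeq_apply_zero_eq_sum (α β γ δ : K) (m : ℕ) (q : ℕ → K) :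
    sbSeq K α β γ δ m q 0 = ∑ s ∈ Finset.range (m + 1), (m.choose s : K) * α ^ (m - s) * γ ^ s * q s := by
  rw [sbSeq_apply_zero, expMul_eq_sum]
  exact Finset.sum_congr rfl fun s _ => by simp only [scaleSeq]; ring

/-- **ALL MOMENTS: `sbSeq α β γ δ m q j = expMul β (scaleSeq δ (t ↦ expMul α (scaleSeq γ (σ^t q)) (m − j))) j` for `j ≤ m`** — the `y`-recursion
`(m+1, j+1) ↦ β·(m, q, j) + δ·(m, σq, j)` is E5's Pascal recursion for the node `β` on the `δ`-scaled sequence of the `0`-th moments of the shifts. -/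
theorem sbSeq_eq_expMul_expMul (α β γ δ : K) :
    ∀ (j m : ℕ) (q : ℕ → K), j ≤ m → sbSeq K α β γ δ m q j = expMul K β (scaleSeq K δ fun t => expMul K α (scaleSeq K γ ((shift K)^[t] q)) (m - j)) j
  | 0, m, q, _ => by
    rw [sbSeq_apply_zero, expMul_zero]
    simp only [scaleSeq, pow_zero, one_mul, Function.iterate_zero, id_eq, Nat.sub_zero]
  | j + 1, m + 1, q, h => by
    rw [sbSeq_succ_succ, sbSeq_eq_expMul_expMul α β γ δ j m q (by omega), sbSeq_eq_expMul_expMul α β γ δ j m (shift K q) (by omega), expMul_succ, shift_scaleSeq,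
      expMul_smul, Nat.succ_sub_succ]
    rfl

/-- **THE DICTIONARY'S DOUBLE BINOMIAL SUM: `sbSeq α β γ δ m q j = Σ_{t ≤ j} Σ_{s ≤ m−j} C(j,t) β^{j−t} δ^t · C(m−j,s) α^{m−j−s} γ^s · q_{s+t}`** (`j ≤ m`) — the moments
`L((αu+γv)^{m−j}(βu+δv)^j)` of the transformed functional. -/
theorem sbSeq_eq_sum (α β γ δ : K) {j m : ℕ} (h : j ≤ m) (q : ℕ → K) :
    sbSeq K α β γ δ m q j = ∑ t ∈ Finset.range (j + 1), ∑ s ∈ Finset.range (m - j + 1),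
      (j.choose t : K) * β ^ (j - t) * δ ^ t * (((m - j).choose s : K) * α ^ (m - j - s) * γ ^ s * q (s + t)) := by
  rw [sbSeq_eq_expMul_expMul K α β γ δ j m q h, expMul_eq_sum]
  refine Finset.sum_congr rfl fun t _ => ?_
  simp only [scaleSeq, expMul_eq_sum, Finset.mul_sum, shift_iterate_apply]
  exact Finset.sum_congr rfl fun s _ => by ring

/-! ## §138. Singular substitutions evaluate the class -/

/-- `β = 0 = δ` (`y ↦ γx`): only the `0`-th moment survives: `sbSeq α 0 γ 0 m q (j+1) = 0`. -/
lemma sbSeq_lower_zero_succ (α γ : K) : ∀ (m : ℕ) (q : ℕ → K) (j : ℕ), sbSeq K α 0 γ 0 m q (j + 1) = 0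
  | 0, _, _ => rfl
  | m + 1, q, j => by rw [sbSeq_succ_succ, zero_mul, zero_mul, add_zero]

/-- **A SINGULAR SUBSTITUTION WITH `α ≠ 0` (`αδ = βγ`) EVALUATES THE CLASS AND PROJECTS IT ONTO THE PURE CLASS OF THE IMAGE LETTER `x + (β/α)y`**:
`Sb α β γ δ (w_n q) = w_n(c · (β/α)^•)` with `c = expMul α (scaleSeq γ q) n = Σ_s C(n,s) α^{n−s} γ^s q_s` (H1's `Sb_w_rank_one` is `α = 1, γ = 0`). -/
theorem Sb_w_of_det_eq_zero {α : K} (hα : α ≠ 0) {β γ δ : K} (hdet : α * δ - β * γ = 0) (q : ℕ → K) :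
    Sb K α β γ δ (w K n n q) = w K n n (fun j => expMul K α (scaleSeq K γ q) n * (β / α) ^ j) := by
  rw [Sb_w_eq_w_expMul K hα, hdet, zero_div]
  refine w_eq_of_agree K n fun j _ => ?_
  have e : ∀ i, sbSeq K α 0 γ 0 n q i = if i = 0 then expMul K α (scaleSeq K γ q) n else 0 := fun i => by
    rcases i with _ | i
    · rw [if_pos rfl, sbSeq_apply_zero]
    · rw [if_neg (Nat.succ_ne_zero i), sbSeq_lower_zero_succ]
  rw [show sbSeq K α 0 γ 0 n q = fun i => if i = 0 then expMul K α (scaleSeq K γ q) n else 0 from funext e, expMul_spike_zero]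

/-- … so its KERNELS are the frame ideal of the image letter: `Kr(univ, Sb α β γ δ (w_n q), k) = Φs (β/α) (xRich(k, 0))` whenever the value `c ≠ 0` (`k ≤ n`; E5 `Kr_w_exp_eq`). -/
theorem Kr_Sb_w_of_det_eq_zero {α : K} (hα : α ≠ 0) {β γ δ : K} (hdet : α * δ - β * γ = 0) {q : ℕ → K} (hc : expMul K α (scaleSeq K γ q) n ≠ 0) {k : ℕ} (hk : k ≤ n) :
    Kr K Finset.univ (Sb K α β γ δ (w K n n q)) k = (xRich K n k 0).map (Φs K (n := n) (β / α)).toLinearMap := by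
  rw [Sb_w_of_det_eq_zero K hα hdet, Kr_w_exp_eq K hk _ hc]

/-- **`α = 0 = γ` (`x ↦ βy`, `y ↦ δy`: everything lands in the `y`-frame): `Sb 0 β 0 δ (w_n q) = w_n(c·δ_n)`**, the POINT class with weight `c = expMul β (scaleSeq δ q) n`. -/
theorem Sb_w_of_alpha_gamma_zero (β δ : K) (q : ℕ → K) :
    Sb K 0 β 0 δ (w K n n q) = w K n n (fun j => if j = n then expMul K β (scaleSeq K δ q) n else 0) := by
  rw [Sb_zero_eq_Ψs_Sb_lower, Sb_w K β 0 δ 0 le_rfl, Ψs_w K le_rfl]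
  refine w_eq_of_agree K n fun j hj => ?_
  rw [rev_apply_of_le K hj]
  by_cases h0 : j = n
  · rw [if_pos h0, h0, Nat.sub_self, sbSeq_apply_zero]
  · rw [if_neg h0, show n - j = (n - j - 1) + 1 by omega, sbSeq_lower_zero_succ]

/-- `α = 0 = β` (`x ↦ 0`, `y ↦ γx + δy`): the moments are `q_m γ^{m−j} δ^j` (`j ≤ m`). -/
theorem sbSeq_alpha_beta_zero (γ δ : K) : ∀ (m : ℕ) (q : ℕ → K) {j : ℕ}, j ≤ m → sbSeq K 0 0 γ δ m q j = q m * γ ^ (m - j) * δ ^ j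
  | 0, q, 0, _ => by rw [sbSeq_zero_zero, pow_zero, pow_zero, mul_one, mul_one]
  | m + 1, q, 0, _ => by
    rw [sbSeq_succ_zero, zero_mul, zero_add, sbSeq_alpha_beta_zero γ δ m (shift K q) (Nat.zero_le _), shift_apply, Nat.sub_zero, Nat.sub_zero, pow_succ]; ring
  | m + 1, q, j + 1, h => by
    rw [sbSeq_succ_succ, zero_mul, zero_add, sbSeq_alpha_beta_zero γ δ m (shift K q) (by omega), shift_apply, Nat.succ_sub_succ, pow_succ]; ring

/-- **`α = 0 = β` (`x ↦ 0`): `Sb 0 0 γ δ (w_n q) = w_n(q_n γ^{n−j} δ^j)`** — only the all-`y` monomial survives: `q_n ·` the volume of the frame `(γ, δ)`. -/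
theorem Sb_w_of_alpha_beta_zero (γ δ : K) (q : ℕ → K) : Sb K 0 0 γ δ (w K n n q) = w K n n (fun j => q n * γ ^ (n - j) * δ ^ j) := by
  rw [Sb_w K 0 0 γ δ le_rfl]
  exact w_eq_of_agree K n fun j hj => sbSeq_alpha_beta_zero K γ δ n q hj

/-! ## §139. Stabilizers: a substitution fixes a node kernel iff it fixes the node -/

/-- **`Kr(univ, Sb α β γ δ (w_n(expMul λ q)), k) = Kr(univ, w_n(expMul λ q), k)` IFF `β + λδ = λ(α + λγ)`** for a node-`λ` class of exact order `P < k` (`k + P ≤ n`), `αδ − βγ ≠ 0`,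
`α + λγ ≠ 0` — a substitution fixes the kernel of a node class iff the node is a FIXED POINT of its Möbius map (H2's Möbius theorem + G7's node Torelli). -/
theorem Kr_Sb_w_expMul_eq_iff {α β γ δ lam : K} (ha : α + lam * γ ≠ 0) (hdet : α * δ - β * γ ≠ 0) {k P : ℕ} (hPk : P < k) (hkP : k + P ≤ n) {q : ℕ → K}
    (hq : ∀ j, P < j → q j = 0) (hqP : q P ≠ 0) :
    Kr K Finset.univ (Sb K α β γ δ (w K n n (expMul K lam q))) k = Kr K Finset.univ (w K n n (expMul K lam q)) k ↔ β + lam * δ = lam * (α + lam * γ) := by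
  rw [Sb_w_expMul_eq_w_expMul K ha]
  have hd : (α * δ - β * γ) / (α + lam * γ) ≠ 0 := div_ne_zero hdet ha
  have hq' : ∀ j, P < j → sbSeq K (α + lam * γ) 0 γ ((α * δ - β * γ) / (α + lam * γ)) n q j = 0 := fun j hj => sbSeq_lower_apply_eq_zero K _ γ _ n hq hj
  have hqP' := sbSeq_lower_apply_self_ne_zero K ha hd γ n (show P ≤ n by omega) hq hqP
  constructor
  · intro h
    have e := (KernelDuality.eq_of_Kr_w_expMul_eq K hPk hPk hkP hkP hq' hqP' hq hqP h).1
    rw [div_eq_iff ha] at e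
    exact e
  · intro h
    have e : (β + lam * δ) / (α + lam * γ) = lam := by rw [div_eq_iff ha]; exact h
    rw [e]
    exact Kr_w_expMul_eq_of_order K lam hkP hq' hqP' hq hqP

/-- **two substitutions give a node class the same kernel iff they move the node to the same place** (same hypotheses for both; orders are kept anyway). -/
theorem Kr_Sb_w_expMul_eq_Kr_iff {α β γ δ α' β' γ' δ' lam : K} (ha : α + lam * γ ≠ 0) (hdet : α * δ - β * γ ≠ 0) (ha' : α' + lam * γ' ≠ 0)
    (hdet' : α' * δ' - β' * γ' ≠ 0) {k P : ℕ} (hPk : P < k) (hkP : k + P ≤ n) {q : ℕ → K} (hq : ∀ j, P < j → q j = 0) (hqP : q P ≠ 0) :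
    Kr K Finset.univ (Sb K α β γ δ (w K n n (expMul K lam q))) k = Kr K Finset.univ (Sb K α' β' γ' δ' (w K n n (expMul K lam q))) k ↔
      (β + lam * δ) / (α + lam * γ) = (β' + lam * δ') / (α' + lam * γ') := by
  rw [Sb_w_expMul_eq_w_expMul K ha, Sb_w_expMul_eq_w_expMul K ha']
  have hq1 : ∀ j, P < j → sbSeq K (α + lam * γ) 0 γ ((α * δ - β * γ) / (α + lam * γ)) n q j = 0 := fun j hj => sbSeq_lower_apply_eq_zero K _ γ _ n hq hj
  have hq2 : ∀ j, P < j → sbSeq K (α' + lam * γ') 0 γ' ((α' * δ' - β' * γ') / (α' + lam * γ')) n q j = 0 := fun j hj => sbSeq_lower_apply_eq_zero K _ γ' _ n hq hj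
  have hqP1 := sbSeq_lower_apply_self_ne_zero K ha (div_ne_zero hdet ha) γ n (show P ≤ n by omega) hq hqP
  have hqP2 := sbSeq_lower_apply_self_ne_zero K ha' (div_ne_zero hdet' ha') γ' n (show P ≤ n by omega) hq hqP
  refine ⟨fun h => (KernelDuality.eq_of_Kr_w_expMul_eq K hPk hPk hkP hkP hq1 hqP1 hq2 hqP2 h).1, fun h => ?_⟩
  rw [h]
  exact Kr_w_expMul_eq_of_order K _ hkP hq1 hqP1 hq2 hqP2

/-! ## §139′. Divisor classes under invertible substitutions -/

/-- a moved node class keeps its confluent Hankel rank: `rank H_k(sbSeq α β γ δ n (expMul λ q)) = min(P, k) + 1` (`αδ − βγ ≠ 0`, exact order `P`, `k + P ≤ n`; H1b + E6). -/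
theorem rank_hankel1_sbSeq_expMul_of_order {α β γ δ : K} (hdet : α * δ - β * γ ≠ 0) (lam : K) {k P : ℕ} (hkP : k + P ≤ n) {q : ℕ → K} (hq : ∀ j, P < j → q j = 0)
    (hqP : q P ≠ 0) : (hankel1 K n k (sbSeq K α β γ δ n (expMul K lam q))).rank = min P k + 1 := by
  rw [rank_hankel1_sbSeq K hdet, rank_hankel1_expMul_of_order K lam hkP hq hqP]

/-- **THE KERNEL OF A MOVED DIVISOR CLASS IS THE INTERSECTION OF THE MOVED NODE KERNELS**: distinct nodes `λ_i` with `α + λ_iγ ≠ 0`, exact orders `P_i`, `k + P_i ≤ n`,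
`D = Σ_i (P_i+1) ≤ n + 1 − k`, `αδ − βγ ≠ 0`, `r > 0`:
`Kr(univ, Sb α β γ δ (w_n(Σ_i expMul λ_i q_i)), k) = ⋂_i (SI_k ⊔ Φs ((β + λ_iδ)/(α + λ_iγ)) (xRich(k, P_i)))`. -/
theorem Kr_Sb_w_expMul_sum_of_le {r : ℕ} (hr : 0 < r) {lam : Fin r → K} (hlam : Function.Injective lam) {P : Fin r → ℕ} {q : Fin r → ℕ → K}
    (hq : ∀ i j, P i < j → q i j = 0) (hqP : ∀ i, q i (P i) ≠ 0) {α β γ δ : K} (hdet : α * δ - β * γ ≠ 0) (ha : ∀ i, α + lam i * γ ≠ 0) {k : ℕ}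
    (hkP : ∀ i, k + P i ≤ n) (hDn : ∑ i, (P i + 1) ≤ n + 1 - k) :
    Kr K Finset.univ (Sb K α β γ δ (w K n n (fun j => ∑ i, expMul K (lam i) (q i) j))) k =
      ⨅ i, (siegelIdeal K n k ⊔ (xRich K n k (P i)).map (Φs K (n := n) ((β + lam i * δ) / (α + lam i * γ))).toLinearMap) := by
  rw [Sb_w_expMul_sum K α β γ δ lam q ha]
  exact KernelDuality.Kr_w_expMul_sum_eq_iInf_of_le K hr (mobius_comp_injective K hdet hlam ha)
    (q := fun i => sbSeq K (α + lam i * γ) 0 γ ((α * δ - β * γ) / (α + lam i * γ)) n (q i))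
    (fun i j hj => sbSeq_lower_apply_eq_zero K _ γ _ n (hq i) hj)
    (fun i => sbSeq_lower_apply_self_ne_zero K (ha i) (div_ne_zero hdet (ha i)) γ n (by have := hkP i; omega) (hq i) (hqP i)) hkP hDn

end Summit.Ventures.HSemireg.Wedge.HankelFrameChange
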